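import Mathlib
import Literature.MathematicalPhysics.StatisticalMechanics.Crystallization
import Literature.MathematicalPhysics.StatisticalMechanics.LennardJonesClusters

/-!
# Crux `ExactCertificate` (stmt-AtomisticToContinuum-11959), line `closure-makes-nogap-exact`,
# Transfer skeleton IV `SlackRigidity1D` — stub `stub_deleteCrowded`: the crowding surgery

Support file (`--supports stmt-AtomisticToContinuum-11959`); nothing here closes the 3-D crux.

Transfer skeleton IV (`…Cruxes.ExactCertificate.Transfer1D.SlackRigidity1D`, slack rigidity of the
Lennard-Jones CHAIN: the route decl `SlackRigidity` with `3 ↦ 1`) bounds, for the sorted positions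
`y : ℕ → ℝ` of `N` particles on a line with line energy `L_N(y) = ∑_{i<j<N} V(|y j − y i|)`,
`V = lennardJones`, the number of badly spaced particles by the energy slack.  This file proves its
CROWDING SURGERY `stub_deleteCrowded`, the iteration of the two neighbouring stubs
`stub_deleteEnergy` (DELETION IDENTITY: deleting index `i₀`, i.e. `y' k = y k` for `k < i₀` and
`y' k = y (k+1)` for `k ≥ i₀`, removes from the line energy exactly the pairs containing `i₀`) and
`stub_siteEnergyHalf` (QUANTITATIVE CROWDING: the left particle of a closest pair with gap `< 3/4` has
site energy `≥ 1/2`), both of which are taken here as HYPOTHESES (they are proved in their own files):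

from a strictly increasing configuration `y` of `N` reals one obtains, deleting `m` particles,
`n = N − m` strictly increasing reals `z` with all nearest-neighbour gaps `≥ 3/4`, with
`L_n(z) + m/2 ≤ L_N(y)`, and with `#{p-bad gaps of y} ≤ #{p-bad gaps of z} + 2m` for every gap
predicate `p`.

Mechanism.  ONE STEP (`slackCrowd_step`): if some gap is `< 3/4` (so `N ≥ 2`), pick a closest pair
`(i₀, i₀+1)` (`Finset.exists_min_image`), so that all gaps are `≥ δ := y (i₀+1) − y i₀ ∈ (0, 3/4)`,
and delete index `i₀`.  The result `y'` is strictly increasing on `range (N−1)` (`slackCrowd_mono`);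
by the deletion identity and the crowding bound `L_{N−1}(y') + 1/2 ≤ L_N(y)`; and the gaps of `y'`
are those of `y` with indices `≤ i₀ − 2` kept, the two gaps `i₀ − 1`, `i₀` merged into one, and
the gaps `≥ i₀ + 1` shifted down by one index, so for every predicate the bad gaps of `y` other
than `i₀ − 1`, `i₀` inject into the bad gaps of `y'` (`slackCrowd_card`): `# ≤ #' + 2`.
ITERATION (`stub_deleteCrowded`): strong induction on `N`.
-/

noncomputable section

namespace Summit.AtomisticToContinuum.Crystallization.Theorems.ThreeConeCertificateExactCertificate.Transfer1D

open Literature.MathematicalPhysics.StatisticalMechanics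
open scoped BigOperators

/-! ## One deletion: order and gap count -/

/-- Deleting an index from a strictly increasing configuration on `range N` leaves a strictly
increasing configuration on `range (N − 1)`. [folklore] -/
theorem slackCrowd_mono {N i₀ : ℕ} {y y' : ℕ → ℝ}
    (hmono : ∀ i j : ℕ, i < j → j < N → y i < y j)
    (hy' : ∀ k : ℕ, y' k = if k < i₀ then y k else y (k + 1)) :
    ∀ i j : ℕ, i < j → j < N - 1 → y' i < y' j := by
  intro i j hij hj
  rw [hy' i, hy' j]
  split_ifs with h1 h2 h2
  · exact hmono i j hij (by omega)
  · exact hmono i (j + 1) (by omega) (by omega)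
  · exact absurd (lt_trans hij h2) h1
  · exact hmono (i + 1) (j + 1) (by omega) (by omega)

/-- GAP TRANSPORT under the deletion of index `i₀ < N`: the gaps of `y'` are `gap'_l = gap_l` for
`l + 1 < i₀` and `gap'_l = gap_{l+1}` for `i₀ ≤ l` (the gap `l = i₀ − 1`, if any, is the merged one),
so for every predicate `p` the `p`-bad gaps of `y` other than `i₀ − 1`, `i₀` inject
(`l ↦ l` below `i₀`, `l ↦ l − 1` above) into the `p`-bad gaps of `y'`:
`#bad(y) ≤ #bad(y') + 2`. [folklore] -/
theorem slackCrowd_card {N i₀ : ℕ} {y y' : ℕ → ℝ} (hi₀ : i₀ < N)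
    (hy' : ∀ k : ℕ, y' k = if k < i₀ then y k else y (k + 1)) (p : ℝ → Prop) [DecidablePred p] :
    ((Finset.range (N - 1)).filter (fun l => p (y (l + 1) - y l))).card ≤
      ((Finset.range (N - 1 - 1)).filter (fun l => p (y' (l + 1) - y' l))).card + 2 := by
  set S := (Finset.range (N - 1)).filter (fun l => p (y (l + 1) - y l)) with hS
  set T := (Finset.range (N - 1 - 1)).filter (fun l => p (y' (l + 1) - y' l)) with hT
  -- at most the two gaps `i₀ - 1`, `i₀` are lost
  have h1 : S.card ≤ (S \ {i₀ - 1, i₀}).card + 2 := by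
    have h := Finset.card_sdiff_add_card_inter S {i₀ - 1, i₀}
    have h2 : (S ∩ {i₀ - 1, i₀}).card ≤ 2 :=
      (Finset.card_le_card Finset.inter_subset_right).trans Finset.card_le_two
    omega
  -- the others inject into the bad gaps of `y'`
  have h3 : (S \ {i₀ - 1, i₀}).card ≤ T.card := by
    refine Finset.card_le_card_of_injOn (fun l => if l < i₀ then l else l - 1) ?_ ?_
    · intro l hl
      simp only [Finset.coe_sdiff, Set.mem_sdiff, Finset.mem_coe, hS, Finset.mem_filter,
        Finset.mem_range, Finset.mem_insert, Finset.mem_singleton, not_or] at hl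
      obtain ⟨⟨hlN, hpl⟩, hl1, hl2⟩ := hl
      simp only [Finset.mem_coe, hT, Finset.mem_filter, Finset.mem_range]
      split_ifs with h
      · refine ⟨by omega, ?_⟩
        rw [hy' (l + 1), hy' l, if_pos (by omega), if_pos h]
        exact hpl
      · have e1 : l - 1 + 1 = l := by omega
        refine ⟨by omega, ?_⟩
        rw [e1, hy' l, hy' (l - 1), if_neg h, if_neg (by omega), e1]
        exact hpl
    · intro l₁ hl₁ l₂ hl₂ h
      simp only [Finset.coe_sdiff, Set.mem_sdiff, Finset.mem_coe, Finset.mem_insert,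
        Finset.mem_singleton, not_or] at hl₁ hl₂
      dsimp only at h
      split_ifs at h with h₁ h₂ h₂ <;> omega
  omega

/-! ## One step of the crowding surgery -/

/-- ONE STEP of the crowding surgery: if some nearest-neighbour gap of a strictly increasing
configuration `y` on `range N` is `< 3/4`, deleting the left particle `i₀` of a closest pair
(`Finset.exists_min_image`; all gaps are then `≥ δ = y (i₀+1) − y i₀ ∈ (0, 3/4)`) gives a strictly
increasing configuration `y'` on `range (N − 1)` with `L_{N−1}(y') + 1/2 ≤ L_N(y)` (by the deletion
identity `hdel` and the crowding bound `hsite`, the statements of the neighbouring stubs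
`stub_deleteEnergy`, `stub_siteEnergyHalf`) and, for every gap predicate, at most two more bad gaps
before than after (`slackCrowd_card`). [folklore] -/
theorem slackCrowd_step
    (hdel : ∀ (V : ℝ → ℝ) (N i₀ : ℕ) (y y' : ℕ → ℝ), i₀ < N →
      (∀ k : ℕ, y' k = if k < i₀ then y k else y (k + 1)) →
      ∑ i ∈ Finset.range N, ∑ j ∈ Finset.Ico (i + 1) N, V (|y j - y i|) =
        ∑ i ∈ Finset.range (N - 1), ∑ j ∈ Finset.Ico (i + 1) (N - 1), V (|y' j - y' i|) +
          (∑ j ∈ Finset.Ico (i₀ + 1) N, V (|y j - y i₀|) + ∑ p ∈ Finset.range i₀, V (|y i₀ - y p|)))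
    (hsite : ∀ (N i₀ : ℕ) (y : ℕ → ℝ) (δ : ℝ), i₀ + 1 < N → y (i₀ + 1) - y i₀ = δ → 0 < δ →
      δ < 3 / 4 → (∀ k : ℕ, k + 1 < N → δ ≤ y (k + 1) - y k) →
      1 / 2 ≤ ∑ j ∈ Finset.Ico (i₀ + 1) N, lennardJones (|y j - y i₀|) +
        ∑ p ∈ Finset.range i₀, lennardJones (|y i₀ - y p|))
    {N : ℕ} {y : ℕ → ℝ} (hmono : ∀ i j : ℕ, i < j → j < N → y i < y j)
    {i : ℕ} (hi : i + 1 < N) (hlt : y (i + 1) - y i < 3 / 4) :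
    ∃ y' : ℕ → ℝ, (∀ i j : ℕ, i < j → j < N - 1 → y' i < y' j) ∧
      ∑ i ∈ Finset.range (N - 1), ∑ j ∈ Finset.Ico (i + 1) (N - 1), lennardJones (|y' j - y' i|) +
          1 / 2 ≤ ∑ i ∈ Finset.range N, ∑ j ∈ Finset.Ico (i + 1) N, lennardJones (|y j - y i|) ∧
      ∀ (p : ℝ → Prop) [DecidablePred p],
        ((Finset.range (N - 1)).filter (fun l => p (y (l + 1) - y l))).card ≤
          ((Finset.range (N - 1 - 1)).filter (fun l => p (y' (l + 1) - y' l))).card + 2 := by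
  -- a closest pair `(i₀, i₀ + 1)` and its gap `δ`
  obtain ⟨i₀, hi₀mem, hi₀min⟩ := Finset.exists_min_image (Finset.range (N - 1))
    (fun k => y (k + 1) - y k) ⟨i, Finset.mem_range.2 (by omega)⟩
  rw [Finset.mem_range] at hi₀mem
  have hi₀N : i₀ + 1 < N := by omega
  obtain ⟨δ, hδ⟩ : ∃ δ : ℝ, y (i₀ + 1) - y i₀ = δ := ⟨_, rfl⟩
  have hδpos : 0 < δ := by
    rw [← hδ]
    exact sub_pos.2 (hmono i₀ (i₀ + 1) (Nat.lt_succ_self _) hi₀N)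
  have hgap : ∀ k, k + 1 < N → δ ≤ y (k + 1) - y k := fun k hk => by
    rw [← hδ]
    exact hi₀min k (Finset.mem_range.2 (by omega))
  have hδlt : δ < 3 / 4 := (hgap i hi).trans_lt hlt
  -- delete index `i₀`
  obtain ⟨y', hy'⟩ : ∃ y' : ℕ → ℝ, ∀ k, y' k = if k < i₀ then y k else y (k + 1) :=
    ⟨_, fun _ => rfl⟩
  refine ⟨y', slackCrowd_mono hmono hy', ?_, fun p _ => slackCrowd_card (by omega) hy' p⟩
  have h1 := hdel lennardJones N i₀ y y' (by omega) hy'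
  have h2 := hsite N i₀ y δ hi₀N hδ hδpos hδlt hgap
  linarith

/-! ## The stub -/

/-- STUB (B) `stub_deleteCrowded` — CROWDING SURGERY (iteration of the deletion identity and of the
quantitative crowding bound, the first two hypotheses): from a strictly increasing configuration of
`N` reals, deleting `m` particles (always the left particle of a currently closest pair while its gap
is `< 3/4`) leaves `n = N − m` strictly increasing reals with all gaps `≥ 3/4`, line energy lower by
at least `m/2`, and — since a deletion merges two gaps and keeps the others — for every gap predicate
at most `2m` more bad gaps before than after.  Strong induction on `N` over `slackCrowd_step`. [folklore] -/
theorem stub_deleteCrowded :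
    (∀ (V : ℝ → ℝ) (N i₀ : ℕ) (y y' : ℕ → ℝ), i₀ < N →
      (∀ k : ℕ, y' k = if k < i₀ then y k else y (k + 1)) →
      ∑ i ∈ Finset.range N, ∑ j ∈ Finset.Ico (i + 1) N, V (|y j - y i|) =
        ∑ i ∈ Finset.range (N - 1), ∑ j ∈ Finset.Ico (i + 1) (N - 1), V (|y' j - y' i|) +
          (∑ j ∈ Finset.Ico (i₀ + 1) N, V (|y j - y i₀|) + ∑ p ∈ Finset.range i₀, V (|y i₀ - y p|))) →
    (∀ (N i₀ : ℕ) (y : ℕ → ℝ) (δ : ℝ), i₀ + 1 < N → y (i₀ + 1) - y i₀ = δ → 0 < δ → δ < 3 / 4 →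
      (∀ k : ℕ, k + 1 < N → δ ≤ y (k + 1) - y k) →
      1 / 2 ≤ ∑ j ∈ Finset.Ico (i₀ + 1) N, lennardJones (|y j - y i₀|) +
        ∑ p ∈ Finset.range i₀, lennardJones (|y i₀ - y p|)) →
    ∀ (N : ℕ) (y : ℕ → ℝ), (∀ i j : ℕ, i < j → j < N → y i < y j) →
      ∃ (m n : ℕ) (z : ℕ → ℝ), m + n = N ∧ (∀ i j : ℕ, i < j → j < n → z i < z j) ∧
        (∀ i : ℕ, i + 1 < n → 3 / 4 ≤ z (i + 1) - z i) ∧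
        ∑ i ∈ Finset.range n, ∑ j ∈ Finset.Ico (i + 1) n, lennardJones (|z j - z i|) + m / 2 ≤
          ∑ i ∈ Finset.range N, ∑ j ∈ Finset.Ico (i + 1) N, lennardJones (|y j - y i|) ∧
        ∀ (p : ℝ → Prop) [DecidablePred p],
          ((Finset.range (N - 1)).filter (fun l => p (y (l + 1) - y l))).card ≤
            ((Finset.range (n - 1)).filter (fun l => p (z (l + 1) - z l))).card + 2 * m := by
  intro hdel hsite N
  induction N using Nat.strong_induction_on with
  | _ N ih =>
  intro y hmono
  by_cases hcrowd : ∃ i : ℕ, i + 1 < N ∧ y (i + 1) - y i < 3 / 4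
  · -- one deletion, then the induction hypothesis at `N - 1`
    obtain ⟨i, hi, hlt⟩ := hcrowd
    obtain ⟨y', hmono', hE', hcard'⟩ := slackCrowd_step hdel hsite hmono hi hlt
    obtain ⟨m', n, z, hmn, hzmono, hzgap, hzE, hzcard⟩ := ih (N - 1) (by omega) y' hmono'
    refine ⟨m' + 1, n, z, by omega, hzmono, hzgap, ?_, fun p _ => ?_⟩
    · push_cast
      linarith
    · have h1 := hcard' p
      have h2 := hzcard p
      omega
  · -- all gaps are already `≥ 3/4`: nothing to delete
    push Not at hcrowd
    exact ⟨0, N, y, by omega, hmono, hcrowd, by simp, fun p _ => by simp⟩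

end Summit.AtomisticToContinuum.Crystallization.Theorems.ThreeConeCertificateExactCertificate.Transfer1D

end
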